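import Summits.QuantumAdvantage.QuantumAdvantage.Theorems.LinnikCubicClassGroupsDegreeOnePrimesEscapeClassPNTSmoothed
import Literature.NumberTheory.LFunctions.RayClassFamilyZeroSum
import Literature.NumberTheory.LFunctions.RayClassSmoothedPsi
import Literature.NumberTheory.LFunctions.RayClassImprimitiveCoefficients
import Literature.NumberTheory.LFunctions.DedekindZetaExplicitFormula
import HarnessLib

/-!
# Linnik's theorem for cosets of a congruence class group, II: the smoothed coset sums through the explicit
# formulae of the whole family, two-sided, with the exceptional zeros kept

Topic `Summits/QuantumAdvantage/QuantumAdvantage/Theorems`, cell B2b-1 (linnik-cubic), PART A (gen 22); helper toward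
the crux `DegreeOnePrimesEscape` (stmt-QuantumAdvantage-11543) of route `LinnikCubicClassGroups` — the ray-class
counterpart of `…ClassPNTSmoothed`.  HONEST FRAMING: the value of this file is a THEOREM (kernel-checked, GRH-free) —
NOT summit progress.

For a number field `K`, an abelian Frobenius datum `f : 𝔭 ↦ f 𝔭 ∈ G` killing the narrow ray `mod 𝔪 ≠ 0` whose
non-trivial characters are non-principal off `𝔪`, a coset `τ ∈ G`, the weight `g = tzTest (log x) ε`, its Laplace
transform `F` and the family `F_ψ = rayFamF … ψ` (`F_0 = ζ₁_K`, `F_ψ = L_ψ`), orthogonality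
(`card_mul_smoothedPsiFiber`: `|G| ψ̃_τ(g) = Σ_χ χ(τ)⁻¹ K_{g,Λ^𝔪_χ}(0)`), the passage from the imprimitive coefficients
`Λ^𝔪_χ` to the primitive ones (`RayClassImprimitiveCoefficients`, cost `2(L+2) log N𝔪` per character) and the exact
explicit formulae (`coefFordK_one_eq_explicit` for `ζ_K`, `rcCoefFordK_eq_explicit` for `L_ψ`) give, TWO-SIDEDLY
and with a prescribed finite set `Exc ψ` of non-trivial zeros of `F_ψ` kept on the main-term side,

  `‖|G| ψ̃_τ(g) − F(−1) + Σ_ψ ψ(τ)⁻¹ Σ_{ρ ∈ Exc ψ} m_ψ(ρ) F(−ρ)‖ ≤ Bf + |G| (M₀ + J + 2(log x + 2) log N𝔪)`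

(`norm_card_mul_smoothedPsiFiber_sub_le`), where `Bf` bounds the zero terms over the zeros NOT in `Exc ψ` (all
finite partial sums, as supplied by `rayFam_zeroSum_le_zfr`), `M₀` the trivial-zero terms and `J` the left-line
integrals (per character: `norm_coefFordK_rayFamF_sub_le`).
References: J. Thorner, A. Zaman, Algebra Number Theory 11 (2017), §§8–9 [ThornerZaman2017]; A. Weiss, J. reine
angew. Math. 338 (1983), §5 [Weiss1983].
-/

noncomputable section

open Complex Real Set Filter Topology NumberField IsDedekindDomain
open scoped NumberField nonZeroDivisors

namespace Summit.QuantumAdvantage.QuantumAdvantage.Theorems.DegreeOnePrimesEscape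

open Literature.NumberTheory.LFunctions Literature.NumberTheory.LFunctions.NumberField
  Literature.NumberTheory.LFunctions.EntireEF Literature.NumberTheory.LFunctions.TZWeight
  Literature.NumberTheory.LFunctions.AbelianDensity
open scoped Classical

variable {K : Type} [Field K] [NumberField K]
variable {G : Type} [CommGroup G] [Finite G] {𝔪 : Ideal (𝓞 K)} {f : HeightOneSpectrum (𝓞 K) → G}
variable (h𝔪 : 𝔪 ≠ ⊥) (hray : ArtinKillsRay 𝔪 f)
  (hsep : ∀ χ : AddChar (Additive G) ℂ, χ ≠ 0 →
    ∃ v : HeightOneSpectrum (𝓞 K), ¬ 𝔪 ≤ v.asIdeal ∧ χ (Additive.ofMul (f v)) ≠ 1)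

omit [NumberField K] [Finite G] in
/-- The trivial character of `G` composed with the datum is the constant function `1` on the primes. -/
theorem charFun_zero : charFun f (0 : AddChar (Additive G) ℂ) = fun _ ↦ (1 : ℂ) := by
  funext v; simp [charFun, toMulHom_apply]

/-! ### The explicit formula of `F_ψ` read two-sidedly, exceptional zeros kept -/

set_option maxHeartbeats 800000 in
/-- **The explicit formula of `F_ψ` read two-sidedly through the imprimitive coefficients, exceptional zeros kept.**
For `ψ ∈ Ĝ`, `x > 1`, `0 < ε ≤ 1`, `ε < (log x)/2`, `g = tzTest (log x) ε`, a finite set `Exc` of non-trivial zeros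
of `F_ψ`, a bound `B` for the finite partial sums of `m_ψ ‖F(−ρ)‖` over the non-trivial zeros outside `Exc`, and
bounds `M₀`, `J` for the trivial-zero term `m_ψ(0)(log x + ε)` and the left-line integral:
`‖K_{g,Λ^𝔪_ψ}(0) − [ψ = 0] F(−1) + Σ_{ρ ∈ Exc} m_ψ(ρ) F(−ρ)‖ ≤ B + M₀ + J + 2(log x + 2) log N𝔪`.
[cite: ThornerZaman2017, Lemma 9.3] -/
theorem norm_coefFordK_rayFamF_sub_le (ψ : AddChar (Additive G) ℂ) {x ε : ℝ}
    (hx : 1 < x) (hε : 0 < ε) (hε1 : ε ≤ 1) (hεL : ε < Real.log x / 2)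
    (Exc : Finset ℂ) (hExc : ∀ ρ ∈ Exc, rayFamF h𝔪 hray hsep ψ ρ = 0 ∧ 0 < ρ.re ∧ ρ.re < 1)
    {B M₀ J : ℝ}
    (hB : ∀ u : Finset ℂ, (∀ ρ ∈ u, rayFamF h𝔪 hray hsep ψ ρ = 0 ∧ 0 < ρ.re ∧ ρ.re < 1) →
      ∑ ρ ∈ u with ρ ∉ Exc, (analyticOrderNatAt (rayFamF h𝔪 hray hsep ψ) ρ : ℝ) *
        ‖fordLaplace (tzTest (Real.log x) ε) (-ρ)‖ ≤ B)
    (hM₀ : (analyticOrderNatAt (rayFamF h𝔪 hray hsep ψ) 0 : ℝ) * (Real.log x + ε) ≤ M₀)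
    (hJ0 : ψ = 0 → ‖dzEFRemainder K (tzTest (Real.log x) ε) 0‖ ≤ J)
    (hJ : ∀ hψ : ψ ≠ 0, ‖rcEFRemainder (datumData h𝔪 hray hsep ψ hψ).L (tzTest (Real.log x) ε) 0‖ ≤ J) :
    ‖coefFordK (rcCoef 𝔪 (charFun f ψ)) (tzTest (Real.log x) ε) 0 -
        (if ψ = 0 then fordLaplace (tzTest (Real.log x) ε) (-1) else 0) +
        ∑ ρ ∈ Exc, (analyticOrderNatAt (rayFamF h𝔪 hray hsep ψ) ρ : ℂ) * fordLaplace (tzTest (Real.log x) ε) (-ρ)‖ ≤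
      B + M₀ + J + 2 * (Real.log x + 2) * Real.log (Ideal.absNorm 𝔪 : ℕ) := by
  set Lx := Real.log x with hLx
  have hL : 0 < Lx := Real.log_pos hx
  have hadm := isSmoothedEFTest_tzTest hL hε
  have hg0 : tzTest Lx ε 0 = 0 := tzTest_zero hL hε hεL.le
  have hF0 : ‖fordLaplace₀ (tzTest Lx ε) 0‖ ≤ Lx + ε := by
    rw [fordLaplace₀_eq_fordLaplace hg0]; exact norm_fordLaplace_tzTest_zero_le hL hε hεL
  by_cases hψ : ψ = 0
  · -- `ψ = 0`: `F_0 = ζ₁_K`, coefficients `Λ^𝔪_1` versus `Λ_K`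
    subst hψ
    simp only [if_true]
    have hsz : ∀ ρ : ℂ, dedekindZeta₁ K ρ = 0 → 0 < ρ.re → ρ.re < 1 → ρ ≠ 0 := by
      intro ρ _ h1 _ h; rw [h] at h1; simp at h1
    have hexpl := coefFordK_one_eq_explicit (K := K) hadm hg0 (s := 0) (by norm_num) (by norm_num) hsz
    have hsum := summable_norm_dzZeroTerm (K := K) hadm (s := 0) (by norm_num) hsz
    have hExc' : ∀ ρ ∈ Exc, dedekindZeta₁ K ρ = 0 ∧ 0 < ρ.re ∧ ρ.re < 1 := by
      intro ρ hρ; have := hExc ρ hρ; rwa [rayFamF_zero] at this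
    have hB' : ∀ u : Finset ℂ, (∀ ρ ∈ u, dedekindZeta₁ K ρ = 0 ∧ 0 < ρ.re ∧ ρ.re < 1) →
        ∑ ρ ∈ u with ρ ∉ Exc, (analyticOrderNatAt (dedekindZeta₁ K) ρ : ℝ) *
          ‖fordLaplace (tzTest Lx ε) (-ρ)‖ ≤ B := by
      intro u hu
      have := hB u (fun ρ hρ ↦ by rw [rayFamF_zero]; exact hu ρ hρ)
      simpa only [rayFamF_zero] using this
    have hmain : fordLaplace₀ (tzTest Lx ε) (0 - 1) = fordLaplace (tzTest Lx ε) (-1) := by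
      rw [zero_sub, fordLaplace₀_eq_fordLaplace hg0]
    rw [hmain] at hexpl
    have key := norm_explicit_core hg0 hsum hexpl hF0 Exc hExc' hB'
    have hm : (analyticOrderNatAt (rayFamF h𝔪 hray hsep 0) 0 : ℝ) = (analyticOrderNatAt (dedekindZeta₁ K) 0 : ℝ) := by
      rw [rayFamF_zero]
    rw [hm] at hM₀
    have hJ' := hJ0 rfl
    have hsumE : ∑ ρ ∈ Exc, (analyticOrderNatAt (rayFamF h𝔪 hray hsep 0) ρ : ℂ) * fordLaplace (tzTest Lx ε) (-ρ) =
        ∑ ρ ∈ Exc, (analyticOrderNatAt (dedekindZeta₁ K) ρ : ℂ) * fordLaplace (tzTest Lx ε) (-ρ) := by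
      refine Finset.sum_congr rfl fun ρ _ ↦ ?_
      rw [rayFamF_zero]
    rw [hsumE, charFun_zero]
    -- the imprimitive correction
    have hcorr := norm_coefFordK_tzTest_one_sub_le (K := K) h𝔪 hL hε hε1
    have htri : ‖coefFordK (rcCoef 𝔪 (fun _ ↦ (1 : ℂ))) (tzTest Lx ε) 0 - fordLaplace (tzTest Lx ε) (-1) +
        ∑ ρ ∈ Exc, (analyticOrderNatAt (dedekindZeta₁ K) ρ : ℂ) * fordLaplace (tzTest Lx ε) (-ρ)‖ ≤
        ‖coefFordK (cgCoef (1 : ClassGroup (𝓞 K) →* ℂˣ)) (tzTest Lx ε) 0 - fordLaplace (tzTest Lx ε) (-1) +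
          ∑ ρ ∈ Exc, (analyticOrderNatAt (dedekindZeta₁ K) ρ : ℂ) * fordLaplace (tzTest Lx ε) (-ρ)‖ +
        ‖coefFordK (rcCoef 𝔪 (fun _ ↦ (1 : ℂ))) (tzTest Lx ε) 0 -
          coefFordK (cgCoef (1 : ClassGroup (𝓞 K) →* ℂˣ)) (tzTest Lx ε) 0‖ := by
      have e : coefFordK (rcCoef 𝔪 (fun _ ↦ (1 : ℂ))) (tzTest Lx ε) 0 - fordLaplace (tzTest Lx ε) (-1) +
          ∑ ρ ∈ Exc, (analyticOrderNatAt (dedekindZeta₁ K) ρ : ℂ) * fordLaplace (tzTest Lx ε) (-ρ) =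
          (coefFordK (cgCoef (1 : ClassGroup (𝓞 K) →* ℂˣ)) (tzTest Lx ε) 0 - fordLaplace (tzTest Lx ε) (-1) +
            ∑ ρ ∈ Exc, (analyticOrderNatAt (dedekindZeta₁ K) ρ : ℂ) * fordLaplace (tzTest Lx ε) (-ρ)) +
          (coefFordK (rcCoef 𝔪 (fun _ ↦ (1 : ℂ))) (tzTest Lx ε) 0 -
            coefFordK (cgCoef (1 : ClassGroup (𝓞 K) →* ℂˣ)) (tzTest Lx ε) 0) := by ring
      rw [e]; exact norm_add_le _ _
    refine htri.trans ?_
    have := mul_le_mul_of_nonneg_left hF0 (Nat.cast_nonneg (analyticOrderNatAt (dedekindZeta₁ K) 0))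
    linarith
  · -- `ψ ≠ 0`: `F_ψ = L_ψ`, coefficients `Λ^𝔪_ψ` versus `Λ_{χ₀}`
    simp only [hψ, if_false, sub_zero]
    set D := datumData h𝔪 hray hsep ψ hψ with hD
    have hnt := charFun_nontrivial hsep hψ
    have hFψ : rayFamF h𝔪 hray hsep ψ = D.L := rayFamF_of_ne h𝔪 hray hsep hψ
    have hsz : ∀ ρ : ℂ, D.L ρ = 0 → 0 < ρ.re → ρ.re < 1 → ρ ≠ 0 := by
      intro ρ _ h1 _ h; rw [h] at h1; simp at h1
    have hexpl := rcCoefFordK_eq_explicit D.isRayClassCharacter D.isPrimitive D.isSignType D.ne_bot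
      (D.nontrivial hnt) D.differentiable D.L_eq D.differentiable_Lconj (fun s hs ↦ D.Lconj_eq hs) hadm hg0
      (s := 0) (by norm_num) (by norm_num) hsz
    have hsum := summable_norm_rcZeroTerm D.isRayClassCharacter D.isPrimitive D.isSignType D.ne_bot
      (D.nontrivial hnt) D.differentiable D.L_eq D.differentiable_Lconj (fun s hs ↦ D.Lconj_eq hs) hadm
      (s := 0) (by norm_num) hsz
    have hExc' : ∀ ρ ∈ Exc, D.L ρ = 0 ∧ 0 < ρ.re ∧ ρ.re < 1 := by
      intro ρ hρ; have := hExc ρ hρ; rwa [hFψ] at this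
    have hB' : ∀ u : Finset ℂ, (∀ ρ ∈ u, D.L ρ = 0 ∧ 0 < ρ.re ∧ ρ.re < 1) →
        ∑ ρ ∈ u with ρ ∉ Exc, (analyticOrderNatAt D.L ρ : ℝ) * ‖fordLaplace (tzTest Lx ε) (-ρ)‖ ≤ B := by
      intro u hu
      have := hB u (fun ρ hρ ↦ by rw [hFψ]; exact hu ρ hρ)
      simpa only [hFψ] using this
    have hexpl' : coefFordK (rcCoef D.𝔣 D.χ₀) (tzTest Lx ε) 0 = 0 -
        (∑' ρ : nontrivialZeros D.L,
          (analyticOrderNatAt D.L (ρ : ℂ) : ℂ) * fordLaplace₀ (tzTest Lx ε) (0 - ρ)) -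
        (analyticOrderNatAt D.L 0 : ℂ) * fordLaplace₀ (tzTest Lx ε) 0 + rcEFRemainder D.L (tzTest Lx ε) 0 := by
      rw [hexpl]; ring
    have key := norm_explicit_core hg0 hsum hexpl' hF0 Exc hExc' hB'
    have hm : (analyticOrderNatAt (rayFamF h𝔪 hray hsep ψ) 0 : ℝ) = (analyticOrderNatAt D.L 0 : ℝ) := by rw [hFψ]
    rw [hm] at hM₀
    have hJ' := hJ hψ
    have hsumE : ∑ ρ ∈ Exc, (analyticOrderNatAt (rayFamF h𝔪 hray hsep ψ) ρ : ℂ) * fordLaplace (tzTest Lx ε) (-ρ) =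
        ∑ ρ ∈ Exc, (analyticOrderNatAt D.L ρ : ℂ) * fordLaplace (tzTest Lx ε) (-ρ) := by
      refine Finset.sum_congr rfl fun ρ _ ↦ ?_
      rw [hFψ]
    rw [hsumE]
    rw [sub_zero] at key
    -- the imprimitive correction
    have hcorr := D.norm_coefFordK_tzTest_sub_le hL hε hε1
    have htri : ‖coefFordK (rcCoef 𝔪 (charFun f ψ)) (tzTest Lx ε) 0 +
        ∑ ρ ∈ Exc, (analyticOrderNatAt D.L ρ : ℂ) * fordLaplace (tzTest Lx ε) (-ρ)‖ ≤
        ‖coefFordK (rcCoef D.𝔣 D.χ₀) (tzTest Lx ε) 0 +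
          ∑ ρ ∈ Exc, (analyticOrderNatAt D.L ρ : ℂ) * fordLaplace (tzTest Lx ε) (-ρ)‖ +
        ‖coefFordK (rcCoef 𝔪 (charFun f ψ)) (tzTest Lx ε) 0 - coefFordK (rcCoef D.𝔣 D.χ₀) (tzTest Lx ε) 0‖ := by
      have e : coefFordK (rcCoef 𝔪 (charFun f ψ)) (tzTest Lx ε) 0 +
          ∑ ρ ∈ Exc, (analyticOrderNatAt D.L ρ : ℂ) * fordLaplace (tzTest Lx ε) (-ρ) =
          (coefFordK (rcCoef D.𝔣 D.χ₀) (tzTest Lx ε) 0 +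
            ∑ ρ ∈ Exc, (analyticOrderNatAt D.L ρ : ℂ) * fordLaplace (tzTest Lx ε) (-ρ)) +
          (coefFordK (rcCoef 𝔪 (charFun f ψ)) (tzTest Lx ε) 0 - coefFordK (rcCoef D.𝔣 D.χ₀) (tzTest Lx ε) 0) := by
        ring
      rw [e]; exact norm_add_le _ _
    refine htri.trans ?_
    have := mul_le_mul_of_nonneg_left hF0 (Nat.cast_nonneg (analyticOrderNatAt D.L 0))
    linarith

/-! ### The assembly over the family -/

set_option maxHeartbeats 1600000 in
/-- **The smoothed coset sum through the family, two-sided, exceptional zeros kept.**  For `x > 1`, `0 < ε ≤ 1`,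
`ε < (log x)/2`, `g = tzTest (log x) ε`, a coset `τ ∈ G`, finite sets `Exc ψ` of non-trivial zeros of `F_ψ` containing
all those in the exceptional segment `rayExcRegion c K 𝔪`, a FAMILY bound `Bf` for the finite partial sums of the zero
terms off the segment (the conclusion of `rayFam_zeroSum_le_zfr`), and bounds `M₀`, `J` for the trivial-zero terms and
the left-line integrals of every member:
`‖|G| ψ̃_τ(g) − F(−1) + Σ_ψ ψ(τ)⁻¹ Σ_{ρ ∈ Exc ψ} m_ψ(ρ) F(−ρ)‖ ≤ Bf + |G| (M₀ + J + 2(log x + 2) log N𝔪)`.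
[cite: ThornerZaman2017, §8 (8.2)–(8.3)] [cite: Weiss1983, §5] -/
theorem norm_card_mul_smoothedPsiFiber_sub_le {x ε c : ℝ} (hx : 1 < x) (hε : 0 < ε) (hε1 : ε ≤ 1)
    (hεL : ε < Real.log x / 2) (τ : G)
    (Exc : AddChar (Additive G) ℂ → Finset ℂ)
    (hExc : ∀ ψ, ∀ ρ ∈ Exc ψ, rayFamF h𝔪 hray hsep ψ ρ = 0 ∧ 0 < ρ.re ∧ ρ.re < 1)
    (hExc' : ∀ ψ ρ, rayFamF h𝔪 hray hsep ψ ρ = 0 → 0 < ρ.re → ρ.re < 1 → rayExcRegion c K 𝔪 ρ → ρ ∈ Exc ψ)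
    {Bf M₀ J : ℝ}
    (hBf : ∀ u : AddChar (Additive G) ℂ → Finset ℂ,
        (∀ ψ, ∀ ρ ∈ u ψ, rayFamF h𝔪 hray hsep ψ ρ = 0 ∧ 0 < ρ.re ∧ ρ.re < 1) →
        ∑ ψ, ∑ ρ ∈ u ψ with ¬ rayExcRegion c K 𝔪 ρ,
            (analyticOrderNatAt (rayFamF h𝔪 hray hsep ψ) ρ : ℝ) * ‖fordLaplace (tzTest (Real.log x) ε) (-ρ)‖ ≤ Bf)
    (hM₀ : ∀ ψ, (analyticOrderNatAt (rayFamF h𝔪 hray hsep ψ) 0 : ℝ) * (Real.log x + ε) ≤ M₀)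
    (hJ0 : ‖dzEFRemainder K (tzTest (Real.log x) ε) 0‖ ≤ J)
    (hJ : ∀ (ψ : AddChar (Additive G) ℂ) (hψ : ψ ≠ 0),
      ‖rcEFRemainder (datumData h𝔪 hray hsep ψ hψ).L (tzTest (Real.log x) ε) 0‖ ≤ J) :
    ‖(Nat.card G : ℂ) * (smoothedPsiFiber 𝔪 f τ (tzTest (Real.log x) ε) : ℂ) -
        fordLaplace (tzTest (Real.log x) ε) (-1) +
        ∑ ψ : AddChar (Additive G) ℂ, (ψ (Additive.ofMul τ))⁻¹ *
          ∑ ρ ∈ Exc ψ, (analyticOrderNatAt (rayFamF h𝔪 hray hsep ψ) ρ : ℂ) *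
            fordLaplace (tzTest (Real.log x) ε) (-ρ)‖ ≤
      Bf + (Nat.card G : ℝ) * (M₀ + J + 2 * (Real.log x + 2) * Real.log (Ideal.absNorm 𝔪 : ℕ)) := by
  set Lx := Real.log x with hLx
  have hL : 0 < Lx := Real.log_pos hx
  set g := tzTest Lx ε with hg
  have hg0' : ∀ u, Lx + ε ≤ u → g u = 0 := fun u hu ↦ tzTest_eq_zero_of_ge hL hε hu
  set Ecorr : ℝ := 2 * (Lx + 2) * Real.log (Ideal.absNorm 𝔪 : ℕ) with hEcorr
  -- the per-character suprema
  set P : AddChar (Additive G) ℂ → Finset ℂ → ℝ := fun ψ u ↦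
    ∑ ρ ∈ u with ((rayFamF h𝔪 hray hsep ψ ρ = 0 ∧ 0 < ρ.re ∧ ρ.re < 1) ∧ ρ ∉ Exc ψ),
      (analyticOrderNatAt (rayFamF h𝔪 hray hsep ψ) ρ : ℝ) * ‖fordLaplace g (-ρ)‖ with hP
  have hP0 : ∀ ψ u, 0 ≤ P ψ u := fun ψ u ↦
    Finset.sum_nonneg fun ρ _ ↦ mul_nonneg (Nat.cast_nonneg _) (norm_nonneg _)
  have hPB : ∀ u : AddChar (Additive G) ℂ → Finset ℂ, ∑ ψ, P ψ (u ψ) ≤ Bf := by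
    intro u
    have h := hBf (fun ψ ↦ (u ψ).filter (fun ρ ↦ rayFamF h𝔪 hray hsep ψ ρ = 0 ∧ 0 < ρ.re ∧ ρ.re < 1))
      (fun ψ ρ hρ ↦ (Finset.mem_filter.1 hρ).2)
    refine le_trans (Finset.sum_le_sum fun ψ _ ↦ ?_) h
    rw [hP]; dsimp only
    rw [Finset.filter_filter]
    refine Finset.sum_le_sum_of_subset_of_nonneg (fun ρ hρ ↦ ?_)
      fun ρ _ _ ↦ mul_nonneg (Nat.cast_nonneg _) (norm_nonneg _)
    rw [Finset.mem_filter] at hρ ⊢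
    refine ⟨hρ.1, hρ.2.1, fun hexc ↦ hρ.2.2 (hExc' ψ ρ hρ.2.1.1 hρ.2.1.2.1 hρ.2.1.2.2 hexc)⟩
  have hsup := sum_ciSup_le_of_forall_sum_le P hP0 hPB
  have hbdd : ∀ ψ, BddAbove (Set.range (P ψ)) := by
    intro ψ
    refine ⟨Bf, ?_⟩
    rintro _ ⟨u, rfl⟩
    have h := hPB (Function.update (fun _ ↦ (∅ : Finset ℂ)) ψ u)
    have hle : P ψ u ≤ ∑ φ, P φ (Function.update (fun _ ↦ (∅ : Finset ℂ)) ψ u φ) := by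
      rw [← Finset.sum_erase_add _ _ (Finset.mem_univ ψ)]
      simp only [Function.update_self]
      have : 0 ≤ ∑ φ ∈ Finset.univ.erase ψ, P φ (Function.update (fun _ ↦ (∅ : Finset ℂ)) ψ u φ) :=
        Finset.sum_nonneg fun φ _ ↦ hP0 _ _
      linarith
    exact hle.trans h
  -- the per-character estimate with `B_ψ = ⨆_u P ψ u`
  have hper : ∀ ψ : AddChar (Additive G) ℂ,
      ‖coefFordK (rcCoef 𝔪 (charFun f ψ)) g 0 - (if ψ = 0 then fordLaplace g (-1) else 0) +
          ∑ ρ ∈ Exc ψ, (analyticOrderNatAt (rayFamF h𝔪 hray hsep ψ) ρ : ℂ) * fordLaplace g (-ρ)‖ ≤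
        (⨆ u, P ψ u) + M₀ + J + Ecorr := by
    intro ψ
    refine norm_coefFordK_rayFamF_sub_le h𝔪 hray hsep ψ hx hε hε1 hεL (Exc ψ) (hExc ψ) (fun u hu ↦ ?_) (hM₀ ψ)
      (fun _ ↦ hJ0) (fun h0 ↦ hJ ψ h0)
    refine le_trans (le_of_eq ?_) (le_ciSup (hbdd ψ) u)
    rw [hP]; dsimp only
    refine Finset.sum_congr (Finset.filter_congr fun ρ hρ ↦ ?_) fun _ _ ↦ rfl
    exact ⟨fun h ↦ ⟨hu ρ hρ, h⟩, fun h ↦ h.2⟩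
  -- orthogonality
  have horth := card_mul_smoothedPsiFiber (𝔪 := 𝔪) (f := f) τ hg0'
  have hmain : ∑ ψ : AddChar (Additive G) ℂ,
      (ψ (Additive.ofMul τ))⁻¹ * (if ψ = 0 then fordLaplace g (-1) else 0) = fordLaplace g (-1) := by
    rw [Finset.sum_eq_single (0 : AddChar (Additive G) ℂ)]
    · rw [if_pos rfl, AddChar.zero_apply, inv_one, one_mul]
    · intro ψ _ hψ; rw [if_neg hψ, mul_zero]
    · intro h; exact absurd (Finset.mem_univ _) h
  have hid : (Nat.card G : ℂ) * (smoothedPsiFiber 𝔪 f τ g : ℂ) - fordLaplace g (-1) +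
      ∑ ψ : AddChar (Additive G) ℂ, (ψ (Additive.ofMul τ))⁻¹ *
        ∑ ρ ∈ Exc ψ, (analyticOrderNatAt (rayFamF h𝔪 hray hsep ψ) ρ : ℂ) * fordLaplace g (-ρ) =
      ∑ ψ : AddChar (Additive G) ℂ, (ψ (Additive.ofMul τ))⁻¹ *
        (coefFordK (rcCoef 𝔪 (charFun f ψ)) g 0 - (if ψ = 0 then fordLaplace g (-1) else 0) +
          ∑ ρ ∈ Exc ψ, (analyticOrderNatAt (rayFamF h𝔪 hray hsep ψ) ρ : ℂ) * fordLaplace g (-ρ)) := by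
    rw [horth]
    simp only [mul_add, mul_sub, Finset.sum_add_distrib, Finset.sum_sub_distrib, hmain]
  rw [hid]
  have hcard : (Finset.univ : Finset (AddChar (Additive G) ℂ)).card = Nat.card G := by
    rw [Finset.card_univ, card_addChar_eq_natCard]
  calc ‖∑ ψ : AddChar (Additive G) ℂ, (ψ (Additive.ofMul τ))⁻¹ *
        (coefFordK (rcCoef 𝔪 (charFun f ψ)) g 0 - (if ψ = 0 then fordLaplace g (-1) else 0) +
          ∑ ρ ∈ Exc ψ, (analyticOrderNatAt (rayFamF h𝔪 hray hsep ψ) ρ : ℂ) * fordLaplace g (-ρ))‖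
      ≤ ∑ ψ : AddChar (Additive G) ℂ, ‖(ψ (Additive.ofMul τ))⁻¹ *
        (coefFordK (rcCoef 𝔪 (charFun f ψ)) g 0 - (if ψ = 0 then fordLaplace g (-1) else 0) +
          ∑ ρ ∈ Exc ψ, (analyticOrderNatAt (rayFamF h𝔪 hray hsep ψ) ρ : ℂ) * fordLaplace g (-ρ))‖ :=
        norm_sum_le _ _
    _ ≤ ∑ ψ : AddChar (Additive G) ℂ, ((⨆ u, P ψ u) + M₀ + J + Ecorr) := by
        refine Finset.sum_le_sum fun ψ _ ↦ ?_
        rw [norm_mul, norm_inv, AddChar.norm_apply, inv_one, one_mul]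
        exact hper ψ
    _ = ∑ ψ : AddChar (Additive G) ℂ, (⨆ u, P ψ u) + (Nat.card G : ℝ) * (M₀ + J + Ecorr) := by
        rw [Finset.sum_add_distrib, Finset.sum_add_distrib, Finset.sum_add_distrib, Finset.sum_const,
          Finset.sum_const, Finset.sum_const, nsmul_eq_mul, nsmul_eq_mul, nsmul_eq_mul, hcard]
        ring
    _ ≤ Bf + (Nat.card G : ℝ) * (M₀ + J + Ecorr) := add_le_add hsup le_rfl

end Summit.QuantumAdvantage.QuantumAdvantage.Theorems.DegreeOnePrimesEscape

end
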